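import Literature.Computability.QuantumComplexity.KeyedTruncBlocks
import Literature.Computability.QuantumComplexity.KeyedOracleBlocksUniform
import HarnessLib

/-!
# The keyed TRUNCATED-RUNS blocks family is polynomial-time UNIFORM

Topic `Literature/Computability/QuantumComplexity`; sequel of `KeyedTruncBlocks.lean` (`KeyedBlocks.trunc F nOf κOf`: on
instances of length `L`, `n = nOf L` clipped to `0` unless `(T(n)+1)·n ≤ L`, `T(n)+1` blocks, block `b < T(n)` running the
TRUNCATION of `F.circ n` before its `b`-th oracle gate and block `T(n)` the full run) and `KeyedOracleBlocksUniform.lean`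
(`KeyedBlocks.family_isUniform_of_raw`: a blocks family is uniform as soon as its size functions are computed on unary codes and
its RAW block gate lists are computed on codes). Here the raw block gate lists of the truncated-runs family are made
explicit — the prefix of the raw gate list of `F.circ n` before its `b`-th raw ORACLE gate (tag bit `1`), read off `F`'s own
description — and computed on codes, so that the truncated-runs estimator of Bennett–Bernstein–Brassard–Vazirani 1997
(proof of Cor. 3.4: "run the machine until just before the `i`-th query") behind Zhandry's keys (2012, Thm. 3.1) is ONE
polynomial-time uniform family (Bennett–Bernstein–Brassard–Vazirani 1997, Thm. 4.14; Arora–Barak 2009, §6.2 Remark 6.7).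

* `oracleIdxs rg` — the positions of the raw oracle gates of `rg`; `oracleIdxs_cons`; **`map_oraclePositions_toRaw`** —
  the prefixes recorded by `oraclePositions gs`, gate codes taken, are `rg.take i` over `i ∈ oracleIdxs rg`, `rg = gs.map toRaw`
  (`length_oracleIdxs`, `getElem` form);
* `rawTrunc rg b = rg.take ((oracleIdxs rg).getD b |rg|)`; **`map_truncGates_toRaw`** (`(truncGates gs M b).map toRaw = rawTrunc rg b`);
  `codeFP_oracleIdxs`, `codeFP_rawTrunc`;
* `KeyedBlocks.codeFP_truncNOf` (the clipped input length on unary codes, from `nOf` and `n ↦ T(n)` on unary codes);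
* **`KeyedBlocks.trunc_family_isUniform`** — the truncated-runs blocks family of a uniform `F` is uniform, for `nOf`, `κOf`
  and `n ↦ T(n)` computed on unary codes.

Everything here is PROVED; the definitions are explicit list functions.

## References

* C. H. Bennett, E. Bernstein, G. Brassard, U. Vazirani, *Strengths and weaknesses of quantum computing*, SIAM J.
  Comput. 26 (1997) 1510–1523, Cor. 3.4 (proof), Thm. 4.14 [BennettBernsteinBrassardVazirani1997].
* M. Zhandry, *Secure identity-based encryption in the quantum random oracle model*, CRYPTO 2012, Thm. 3.1 [Zhandry2012].
* S. Arora, B. Barak, *Computational Complexity: A Modern Approach*, CUP 2009, §1.3, §6.1–6.2, Remark 6.7 [AroraBarak2009].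
-/

noncomputable section

namespace Literature.Computability.QuantumComplexity

open _root_.Computability Complexity Complexity.Brick Cryptography
open CodeFP

/-! ### Oracle positions on raw gate lists -/

/-- **The positions of the raw oracle gates** (tag bit `true`) of a raw gate list, in order.
[cite: AroraBarak2009, §6.1 (descriptions of circuits)] -/
def oracleIdxs (rg : List RawGate) : List ℕ :=
  (((List.range rg.length).zip rg).filter fun p => p.2.1).map Prod.fst

/-- `oracleIdxs` on a cons: position `0` if the head is an oracle gate, then the shifted positions of the tail. [folklore] -/
private theorem oracleIdxs_cons (γ : RawGate) (rg : List RawGate) :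
    oracleIdxs (γ :: rg) = (if γ.1 then [0] else []) ++ (oracleIdxs rg).map (· + 1) := by
  unfold oracleIdxs
  rw [List.length_cons, List.range_succ_eq_map, List.zip_cons_cons, List.zip_map_left, List.filter_cons]
  have hf : ((List.zip (List.range rg.length) rg).map (Prod.map Nat.succ id)).filter (fun p => p.2.1) =
      ((List.zip (List.range rg.length) rg).filter (fun p => p.2.1)).map (Prod.map Nat.succ id) := by
    rw [List.filter_map]; rfl
  by_cases h : γ.1 = true
  · simp only [h, ↓reduceIte, List.map_cons, List.singleton_append, List.cons.injEq, true_and, hf, List.map_map]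
    rfl
  · simp only [h, Bool.false_eq_true, ↓reduceIte, List.nil_append, hf, List.map_map]
    rfl

/-- Every oracle position is a position. [folklore] -/
private theorem mem_oracleIdxs_lt {rg : List RawGate} {i : ℕ} (h : i ∈ oracleIdxs rg) : i < rg.length := by
  unfold oracleIdxs at h
  simp only [List.mem_map, List.mem_filter] at h
  obtain ⟨p, ⟨hp, -⟩, rfl⟩ := h
  have := List.of_mem_zip hp
  exact List.mem_range.1 this.1

variable {G : QGateSet} [Encodable G.Op] {N : ℕ}

/-- **The prefixes recorded by `oraclePositions`, gate codes taken, are the raw prefixes before the raw oracle gates.**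
[cite: BennettBernsteinBrassardVazirani1997, Cor. 3.4 (proof: the run before the i-th query)] -/
theorem map_oraclePositions_toRaw : ∀ gs : List (QGate G N),
    (oraclePositions gs).map (fun q => q.1.map QGate.toRaw) =
      (oracleIdxs (gs.map QGate.toRaw)).map fun i => (gs.map QGate.toRaw).take i
  | [] => by simp [oraclePositions, oracleIdxs]
  | (.gate g e) :: gs => by
    have ih := map_oraclePositions_toRaw gs
    rw [oraclePositions, List.map_map, List.map_cons, oracleIdxs_cons]
    have h1 : (QGate.gate g e : QGate G N).toRaw.1 = false := rfl
    have hc : ((fun q : List (QGate G N) × (k : ℕ) × (Fin (k + 1) ↪ Fin N) => q.1.map QGate.toRaw) ∘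
        fun q : List (QGate G N) × (k : ℕ) × (Fin (k + 1) ↪ Fin N) => (QGate.gate g e :: q.1, q.2)) =
          (fun l : List RawGate => (QGate.gate g e : QGate G N).toRaw :: l) ∘
            fun q : List (QGate G N) × (k : ℕ) × (Fin (k + 1) ↪ Fin N) => q.1.map QGate.toRaw := by
      funext q; simp
    rw [hc, ← List.map_map, ih, List.map_map, h1]
    simp only [Bool.false_eq_true, ↓reduceIte, List.nil_append, List.map_map]
    exact List.map_congr_left fun i _ => rfl
  | (.oracle k e) :: gs => by
    have ih := map_oraclePositions_toRaw gs
    rw [oraclePositions, List.map_cons, List.map_map, List.map_cons, oracleIdxs_cons]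
    have h1 : (QGate.oracle k e : QGate G N).toRaw.1 = true := rfl
    have hc : ((fun q : List (QGate G N) × (k : ℕ) × (Fin (k + 1) ↪ Fin N) => q.1.map QGate.toRaw) ∘
        fun q : List (QGate G N) × (k : ℕ) × (Fin (k + 1) ↪ Fin N) => (QGate.oracle k e :: q.1, q.2)) =
          (fun l : List RawGate => (QGate.oracle k e : QGate G N).toRaw :: l) ∘
            fun q : List (QGate G N) × (k : ℕ) × (Fin (k + 1) ↪ Fin N) => q.1.map QGate.toRaw := by
      funext q; simp
    rw [hc, ← List.map_map, ih, List.map_map, h1]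
    simp only [↓reduceIte, List.singleton_append, List.map_cons, List.take_zero, List.map_nil, List.map_map,
      List.cons.injEq, true_and]
    exact List.map_congr_left fun i _ => rfl

/-- The number of raw oracle positions is the number of oracle positions. [cite: BennettBernsteinBrassardVazirani1997, Def. 3.2] -/
theorem length_oracleIdxs (gs : List (QGate G N)) : (oracleIdxs (gs.map QGate.toRaw)).length = (oraclePositions gs).length := by
  have h := congrArg List.length (map_oraclePositions_toRaw gs)
  simp only [List.length_map] at h
  exact h.symm

/-- The `b`-th recorded prefix, gate codes taken, is the raw prefix before the `b`-th raw oracle gate.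
[cite: BennettBernsteinBrassardVazirani1997, Cor. 3.4 (proof)] -/
theorem map_oraclePositions_getElem_toRaw (gs : List (QGate G N)) (b : ℕ) (hb : b < (oraclePositions gs).length) :
    ((oraclePositions gs)[b]).1.map QGate.toRaw =
      (gs.map QGate.toRaw).take ((oracleIdxs (gs.map QGate.toRaw))[b]'(by rw [length_oracleIdxs]; exact hb)) := by
  have h := map_oraclePositions_toRaw gs
  have h1 := List.getElem_of_eq h (i := b) (by rw [List.length_map]; exact hb)
  simp only [List.getElem_map] at h1
  exact h1

/-! ### The raw truncation -/

/-- **The raw block gate list**: the prefix of `rg` before its `b`-th raw oracle gate, or all of `rg` if `b ≥ #oracle gates`.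
[cite: BennettBernsteinBrassardVazirani1997, Cor. 3.4 (proof)] -/
def rawTrunc (rg : List RawGate) (b : ℕ) : List RawGate := rg.take ((oracleIdxs rg).getD b rg.length)

/-- **The block gate lists of the truncated-runs family, gate codes taken, are the raw truncations.**
[cite: BennettBernsteinBrassardVazirani1997, Cor. 3.4 (proof)] -/
theorem map_truncGates_toRaw (gs : List (QGate G N)) (M : ℕ) (b : Fin M) :
    (truncGates gs M b).map QGate.toRaw = rawTrunc (gs.map QGate.toRaw) b := by
  unfold rawTrunc
  by_cases hb : (b : ℕ) < (oraclePositions gs).length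
  · rw [truncGates_of_lt _ _ _ hb, map_oraclePositions_getElem_toRaw gs b hb, List.getD_eq_getElem]
  · push Not at hb
    rw [truncGates_of_le _ _ _ hb, List.getD_eq_default _ _ (by rw [length_oracleIdxs]; exact hb), List.take_length]

/-- The raw truncation index is at most the length. [folklore] -/
private theorem getD_oracleIdxs_le (rg : List RawGate) (b : ℕ) : (oracleIdxs rg).getD b rg.length ≤ rg.length := by
  rw [List.getD_eq_getElem?_getD]
  cases h : (oracleIdxs rg)[b]? with
  | none => simp
  | some i => exact (mem_oracleIdxs_lt (List.mem_of_getElem? h)).le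

/-- `oracleIdxs` is computed on codes. [cite: AroraBarak2009, §1.3] -/
theorem codeFP_oracleIdxs : CodeFP (rawE RawGate.E) (rawE natE) oracleIdxs := by
  have hp : CodeFP (pairE unitE (pairE natE RawGate.E)) bitE (fun t : Unit × (ℕ × RawGate) => t.2.2.1) :=
    RawGate.codeFP_tag.comp (snd _ _).snd'
  have hf := filter (σ := Unit) (eσ := unitE) hp
  have hm : CodeFP (pairE unitE (rawE (pairE natE RawGate.E))) (rawE natE)
      (fun q : Unit × List (ℕ × RawGate) => q.2.map fun a => a.1) := map ((snd _ _).fst')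
  exact ((hm.comp ((const _ ()).pair (hf.comp ((const _ ()).pair (rawEnum RawGate.E))))).congr fun rg => rfl)

/-- **The raw truncation is computed on codes** from `(rg, b)`. [cite: AroraBarak2009, §1.3] -/
theorem codeFP_rawTrunc : CodeFP (pairE (rawE RawGate.E) natE) (rawE RawGate.E) (fun p : List RawGate × ℕ => rawTrunc p.1 p.2) := by
  have hrg : CodeFP (pairE (rawE RawGate.E) natE) (rawE RawGate.E) (fun p : List RawGate × ℕ => p.1) := fst _ _
  have hb : CodeFP (pairE (rawE RawGate.E) natE) natE (fun p : List RawGate × ℕ => p.2) := snd _ _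
  have hlen : CodeFP (pairE (rawE RawGate.E) natE) natE (fun p : List RawGate × ℕ => p.1.length) := (natLength _).comp hrg
  have hidx : CodeFP (pairE (rawE RawGate.E) natE) natE
      (fun p : List RawGate × ℕ => (oracleIdxs p.1).getD p.2 p.1.length) :=
    (rawGetOr natE).comp ((codeFP_oracleIdxs.comp hrg).pair (hb.pair hlen))
  have hu : CodeFP (pairE (rawE RawGate.E) natE) unE
      (fun p : List RawGate × ℕ => min ((oracleIdxs p.1).getD p.2 p.1.length) p.1.length) :=
    unOfNatMin.comp (((ulength _).comp hrg).pair hidx)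
  exact ((rawTakeUn RawGate.E).comp (hu.pair hrg)).congr fun p => by
    show p.1.take (min _ _) = rawTrunc p.1 p.2
    rw [min_eq_left (getD_oracleIdxs_le p.1 p.2), rawTrunc]

/-! ### The truncated-runs family is uniform -/

namespace KeyedBlocks

variable (F : QCircuitFamily cliffordT) (nOf κOf : ℕ → ℕ)

/-- **The clipped input length is computed on unary codes** from `nOf` and `n ↦ T(n)` on unary codes.
[cite: AroraBarak2009, §1.3] -/
theorem codeFP_truncNOf (hT : CodeFP unE unE fun n => (F.circ n).oracleQueries) (hn : CodeFP unE unE nOf) :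
    CodeFP unE unE (truncNOf F nOf) := by
  have hP : CodeFP unE unE (fun L => ((F.circ (nOf L)).oracleQueries + 1) * nOf L) :=
    codeFP_unMul.comp ((unSucc.comp (hT.comp hn)).pair hn)
  have hc : CodeFP unE bitE (fun L => decide (((F.circ (nOf L)).oracleQueries + 1) * nOf L ≤ L)) :=
    natLe.comp ((natOfUn.comp hP).pair natOfUn)
  exact (hc.ite hn (const _ 0)).congr fun L => by simp [truncNOf]

/-- **The raw block gate lists of the truncated-runs family**: the raw truncations of the raw gates of `F.circ n`,
`n` the clipped input length. [cite: BennettBernsteinBrassardVazirani1997, Cor. 3.4 (proof)] -/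
def truncRaw (L b : ℕ) : List RawGate := rawTrunc (F.rawDesc (truncNOf F nOf L)).2.2 b

/-- They are the block gate lists, gate codes taken. [cite: BennettBernsteinBrassardVazirani1997, Cor. 3.4 (proof)] -/
theorem truncRaw_eq (L : ℕ) (b : Fin ((trunc F nOf κOf).MOf L)) :
    truncRaw F nOf L b = ((trunc F nOf κOf).blockGates L b).map QGate.toRaw := by
  rw [trunc_blockGates, map_truncGates_toRaw]
  rfl

/-- The raw block gate lists are computed on codes from `(1^L, b)`. [cite: AroraBarak2009, §6.2 Remark 6.7] -/
theorem codeFP_truncRaw (hF : F.IsUniform) (hT : CodeFP unE unE fun n => (F.circ n).oracleQueries)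
    (hn : CodeFP unE unE nOf) :
    CodeFP (pairE unE natE) (rawE RawGate.E) (fun p : ℕ × ℕ => truncRaw F nOf p.1 p.2) := by
  have hrg : CodeFP unE (rawE RawGate.E) (fun L => (F.rawDesc (truncNOf F nOf L)).2.2) :=
    ((codeFP_rawDesc hF).comp (codeFP_truncNOf F nOf hT hn)).snd'.snd'
  exact (codeFP_rawTrunc.comp ((hrg.comp (fst _ _)).pair (snd _ _))).congr fun p => rfl

/-- **The keyed truncated-runs blocks family is polynomial-time uniform** for a uniform oracle algorithm `F` and
`nOf`, `κOf`, `n ↦ T(n)` computed in polynomial time on unary numerals.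
[cite: BennettBernsteinBrassardVazirani1997, Thm. 4.14] [cite: AroraBarak2009, §6.2 Remark 6.7] [cite: Zhandry2012, Thm. 3.1] -/
theorem trunc_family_isUniform (hF : F.IsUniform) (hT : CodeFP unE unE fun n => (F.circ n).oracleQueries)
    (hn : CodeFP unE unE nOf) (hκ : CodeFP unE unE κOf) : (trunc F nOf κOf).family.IsUniform :=
  (trunc F nOf κOf).family_isUniform_of_raw hF (codeFP_truncNOf F nOf hT hn)
    ((unSucc.comp (hT.comp (codeFP_truncNOf F nOf hT hn))).congr fun _ => rfl) hκ
    (codeFP_truncRaw F nOf hF hT hn) (truncRaw_eq F nOf κOf)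

end KeyedBlocks

end Literature.Computability.QuantumComplexity

end
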